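import Mathlib
import Summits.ResolutionOfSingularities.ResolutionOfSingularities.Theorems.HomologicalConductorPersistenceRecurrenceCover
import Summits.ResolutionOfSingularities.ResolutionOfSingularities.Theorems.HomologicalConductorPersistenceSurfaceStepGenerator
import Summits.ResolutionOfSingularities.ResolutionOfSingularities.Theorems.HomologicalConductorPersistenceCyclicTransferSyzygy
import Literature.RingTheory.CohomologyAnnihilator.TowerRestrict
import HarnessLib

/-!
# Rung S-2 `PersistenceSurface` (stmt-19970), stub C1 (`Sat₄`) — AUSLANDER'S `add`-COVER in the kernel:
# `Ω²(mod V^G) ⊆ add V` (Herzog's lemma, group-free form), the cover step `Ωⁿ ⊆ add V ⇒ Ωⁿ⁺¹ ⊆ add (ΩV ⊕ T)`,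
# and SATURATION `ca(T) = caⁿ⁺²(T) = s̲ann(D)` from TWO explicit syzygy decompositions
# (chain W4.4b, seat res-L1-w44b-stub-4 gen 6; T-V package part 15)

[OURS · L1 w44b · rung S-2] Nothing here is a statement of the manuscript under review (Hironaka 2017);
AI-written, weaker than expert review.

WHY.  The door of record of the rung (`…SaturationResidualFour.persistenceSurface_of_residual₄_of_completedStep'_of_rest'`)
asks at every two-dimensional stage of embedding dimension `≥ 4` for the SATURATION `ca(T) ⊆ ca⁴(T)` (registered
stub `stub_saturationFourSurfaceResidualFour`).  At the cyclic-quotient (toric) stages the chain's memo-level proof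
(res-L1-w44b-idea-1, SC-TORIC v2 §2(e): `Ω M_χ ≅ ⊕_{d ∈ greedy(χ)} M_{n−d}`, block lemma) is a Σ-STABILISATION
argument whose abstract half is in the kernel (res-L1-w44b-stub-2, `…PersistenceRecurrenceCover`: a RECURRENT class
COVERING the `d`-th syzygies decides `ca(T) = caᵈ⁺¹(T)` exactly).  What the engines actually certify per stage is
smaller than «a class covering `Ω³(mod T)`»: they compute the first syzygy of ONE module (`V = k[u,v]` over
`U = V^G`, isotypic piece by isotypic piece) and the first syzygy of ONE finite sum `D` of its summands.  This file
supplies the two missing kernel links: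

* § Cover step — `isRetractOfPower_of_isSyzygy_succ_of_cover`: if every `n`-th syzygy module lies in `add V` and
  `K_V = Ω V` is any first syzygy of `V`, then every `(n+1)`-th syzygy module lies in `add (K_V ⊕ T)` (syzygies of a
  retract + Schanuel, tree `isRetractOfPower_of_isSyzygy_of_isRetractOfPower`).
* § Saturation from two decompositions — **`cohomologyAnnihilator_eq_of_cover_of_omegaStable`**: `T` noetherian,
  `Ωⁿ(mod T) ⊆ add V`, `Ω V ∈ add (D ⊕ T)`, and `D ∈ add (Ω D ⊕ T)` (`D` finitely generated, Ω-STABLE up to free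
  summands) ⟹ **`ca(T) = caⁿ⁺²(T)`**, and **`mem_cohomologyAnnihilator_iff_stablyAnnihilates_of_cover_of_omegaStable`**:
  `x ∈ ca(T) ↔ x ∈ s̲ann(D)` — the class `add (D ⊕ T)` is recurrent and covers `Ωⁿ⁺¹(mod T)`, so stub-2's theorem
  applies.  For `n = 2` this is `Sat₄` together with the EXACT centre `ca = s̲ann(D)`.
* § Herzog's lemma, group-free — **`isRetractOfPower_restrictScalars_of_isSyzygy_two`**: for an algebra `U → V`
  with a `U`-linear retraction `ρ : V → U` of the structure map (`ρ 1 = 1`; e.g. a Reynolds operator), with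
  `Hom_U(V, U)` finitely generated projective over `V` (the Frobenius hypothesis of parts 5/11, true for quotient
  singularities by small groups) and `1 ∈ ca³(V)` (e.g. `V = k[u,v]`, tree `cohomologyAnnihilatorOfDegree_mvPolynomial_eq_top`):
  **every second syzygy `U`-module is a `U`-direct summand of some `Vᵐ`**, i.e. `Ω²(mod U) ⊆ add_U (V|_U)` —
  Auslander–Herzog «`CM(V^G) = add V`» in syzygy language.  Proof: `K ↪ Hom_U(V, K) ↠ K` (`k ↦ (v ↦ ρ(v) k)`,
  `φ ↦ φ 1`) is a `U`-retract; `Hom_U(V, K)` is a second `V`-syzygy (part 5 `exists_isSyzygy_two_coind`), hence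
  stably annihilated by `1 ∈ ca³(V)` (CA1), i.e. a `V`-retract of a finitely generated projective, i.e. of some `Vᵐ`.
  With the cover step: `Ω³(mod U) ⊆ add_U (Ω(V|_U) ⊕ U)` (`isRetractOfPower_of_isSyzygy_three_of_herzog`).

USE (S-2 toric cells, Q14-1 / SC): at `U = k[u,v]^{μ_n(1,q)}` the per-stage certificate for `ca(U) = ca⁴(U) =
⋂_t M_{i_t}M_{n−i_t}` is now: (a) a decomposition `Ω(k[u,v]|_U) ∈ add (D ⊕ U)` with `D = ⊕_t M_{n−i_t}`, (b) a
decomposition `D ∈ add (Ω D ⊕ U)` — both explicit monomial matrices — fed to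
`cohomologyAnnihilator_eq_of_cover_of_omegaStable` with `n = 2` through the Herzog cover (part 16 instantiates
the hypotheses of § Herzog at `1/n(1,q)`).

References: Iyengar–Takahashi, IMRN 2016, arXiv:1404.1476, §2 (Remark 2.13) [`IyengarTakahashi2014`];
M. Auslander, *Rational singularities and almost split sequences*, Trans. AMS 293 (1986); J. Herzog, *Ringe mit nur
endlich vielen Isomorphieklassen von maximalen, unzerlegbaren Cohen–Macaulay-Moduln*, Math. Ann. 233 (1978) —
mechanism only, nothing is cited as a premise; O. Iyama, M. Wemyss, Math. Z. 265 (2010), arXiv:0809.1958, Cor. 2.9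
(the specials/first-syzygy dictionary that names `D`; not used in the proofs).
-/

-- single-problem summit: the doubled namespace component `ResolutionOfSingularities` is forced
set_option linter.dupNamespace false

noncomputable section

open CategoryTheory Literature.RingTheory.CohomologyAnnihilator
open Summit.ResolutionOfSingularities.ResolutionOfSingularities.Theorems.NoZeno.SandwichCluster
open Summit.ResolutionOfSingularities.ResolutionOfSingularities.Theorems.HomologicalConductor.PersistenceSurfaceHullCover
open Summit.ResolutionOfSingularities.ResolutionOfSingularities.Theorems.HomologicalConductor.CompletionAscentSyzygyRetract
open Summit.ResolutionOfSingularities.ResolutionOfSingularities.Theorems.HomologicalConductor.RecurrenceExclusion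
open Summit.ResolutionOfSingularities.ResolutionOfSingularities.Theorems.HomologicalConductor.RecurrenceCover
open Summit.ResolutionOfSingularities.ResolutionOfSingularities.Theorems.HomologicalConductor.PersistenceSurfaceStepGenerator
open Summit.ResolutionOfSingularities.ResolutionOfSingularities.Theorems.HomologicalConductor.PersistenceCyclicTransferSyzygy

universe u

namespace Summit.ResolutionOfSingularities.ResolutionOfSingularities.Theorems.HomologicalConductor.PersistenceAuslanderAddCover

/-! ## The cover step: `Ωⁿ(mod T) ⊆ add V ⇒ Ωⁿ⁺¹(mod T) ⊆ add (Ω V ⊕ T)` -/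

section Cover

variable {T : Type u} [CommRing T]

/-- **The cover step.**  If every `n`-th syzygy module of every finitely generated `T`-module lies in `add V`
and `K_V` is a first syzygy module of `V`, then every `(n+1)`-th syzygy module lies in `add (K_V ⊕ T)`: an
`(n+1)`-th syzygy is a first syzygy of an `n`-th syzygy `L ∈ add V`, and first syzygies of `add V` lie in
`add (Ω V ⊕ T)` (syzygy of a retract, Schanuel). [folklore] -/
theorem isRetractOfPower_of_isSyzygy_succ_of_cover {V KV : ModuleCat.{u} T} {n : ℕ}
    (hcov : ∀ (M L : ModuleCat.{u} T), Module.Finite T M → IsSyzygy n M L → IsRetractOfPower V L)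
    (hKV : IsSyzygy 1 V KV) {M K : ModuleCat.{u} T} (hM : Module.Finite T M)
    (hK : IsSyzygy (n + 1) M K) : IsRetractOfPower (ModuleCat.of T (KV × T)) K := by
  obtain ⟨L, P, hL, hP, hproj, f, g, w, hS⟩ := hK
  exact isRetractOfPower_of_isSyzygy_of_isRetractOfPower hKV (hcov M L hM hL)
    (isSyzygy_one_iff.mpr ⟨P, hP, hproj, f, g, w, hS⟩)

/-- The cover step with a larger generator: if moreover `K_V ⊕ T ∈ add G` then every `(n+1)`-th syzygy module
lies in `add G`. [folklore] -/
theorem isRetractOfPower_of_isSyzygy_succ_of_cover_of_gen {V KV G : ModuleCat.{u} T} {n : ℕ}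
    (hcov : ∀ (M L : ModuleCat.{u} T), Module.Finite T M → IsSyzygy n M L → IsRetractOfPower V L)
    (hKV : IsSyzygy 1 V KV) (hG : IsRetractOfPower G (ModuleCat.of T (KV × T))) {M K : ModuleCat.{u} T}
    (hM : Module.Finite T M) (hK : IsSyzygy (n + 1) M K) : IsRetractOfPower G K :=
  hG.of_isRetractOfPower_gen (isRetractOfPower_of_isSyzygy_succ_of_cover hcov hKV hM hK)

/-- `T` is a projective object of `ModuleCat T`. [folklore] -/
theorem projective_self : Projective (ModuleCat.of T T) :=
  (IsProjective.iff_projective (R := T) T).mp inferInstance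

/-- `K_D ⊕ T` is again a first syzygy module of `D`. [folklore] -/
theorem isSyzygy_one_prod_self {D KD : ModuleCat.{u} T} (hKD : IsSyzygy 1 D KD) :
    IsSyzygy 1 D (ModuleCat.of T (KD × T)) :=
  isSyzygy_one_prod_projective hKD (inferInstance : Module.Finite T (ModuleCat.of T T)) projective_self

end Cover

/-! ## Saturation from two decompositions: `add (D ⊕ T)` is a covering recurrent class -/

section Saturation

variable {T : Type u} [CommRing T]

/-- **The class `add (D ⊕ T)` is RECURRENT when `D ∈ add (Ω D ⊕ T)`**: every `X ∈ add (D ⊕ T)` is a retract of a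
first syzygy module of a member (namely of `(Ω D ⊕ T)ᵐ = Ω(Dᵐ)` up to the free summand, `Dᵐ ∈ add (D ⊕ T)`).
[folklore] -/
theorem exists_retract_isSyzygy_of_omegaStable {D KD : ModuleCat.{u} T} (hKD : IsSyzygy 1 D KD)
    (hD : IsRetractOfPower (ModuleCat.of T (KD × T)) D) (X : ModuleCat.{u} T)
    (hX : IsRetractOfPower (ModuleCat.of T (D × T)) X) :
    ∃ (Y N : ModuleCat.{u} T) (i : X ⟶ N) (r : N ⟶ X),
      IsRetractOfPower (ModuleCat.of T (D × T)) Y ∧ IsSyzygy 1 Y N ∧ i ≫ r = 𝟙 X := by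
  -- `D ⊕ T ∈ add (K_D ⊕ T)`, hence `X ∈ add (K_D ⊕ T)`
  have hG : IsRetractOfPower (ModuleCat.of T (KD × T)) (ModuleCat.of T (D × T)) :=
    hD.prod (isRetractOfPower_prod_right KD)
  obtain ⟨m, i, r, hir⟩ := hG.of_isRetractOfPower_gen hX
  refine ⟨ModuleCat.of T (Fin m → D), ModuleCat.of T (Fin m → (ModuleCat.of T (KD × T))), i, r,
    (isRetractOfPower_fst D (ModuleCat.of T T)).pi m, (isSyzygy_one_prod_self hKD).pi m, hir⟩

/-- Members of `add (D ⊕ T)` are finitely generated when `D` is. [folklore] -/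
theorem finite_of_isRetractOfPower_prod_self {D : ModuleCat.{u} T} [Module.Finite T D] (X : ModuleCat.{u} T)
    (hX : IsRetractOfPower (ModuleCat.of T (D × T)) X) : Module.Finite T X :=
  haveI : Module.Finite T (ModuleCat.of T (D × T)) := inferInstanceAs (Module.Finite T (D × T))
  hX.finite

/-- **`add (D ⊕ T)` COVERS `Ωⁿ⁺¹(mod T)`** when `Ωⁿ(mod T) ⊆ add V` and `Ω V ∈ add (D ⊕ T)`. [folklore] -/
theorem exists_retract_of_isSyzygy_succ_of_cover {V KV D : ModuleCat.{u} T} {n : ℕ}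
    (hcov : ∀ (M L : ModuleCat.{u} T), Module.Finite T M → IsSyzygy n M L → IsRetractOfPower V L)
    (hKV : IsSyzygy 1 V KV) (hKVD : IsRetractOfPower (ModuleCat.of T (D × T)) KV)
    (M K : ModuleCat.{u} T) (hM : Module.Finite T M) (hK : IsSyzygy (n + 1) M K) :
    ∃ (X : ModuleCat.{u} T) (i : K ⟶ X) (r : X ⟶ K), IsRetractOfPower (ModuleCat.of T (D × T)) X ∧ i ≫ r = 𝟙 K :=
  ⟨K, 𝟙 K, 𝟙 K, isRetractOfPower_of_isSyzygy_succ_of_cover_of_gen hcov hKV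
    (hKVD.prod (isRetractOfPower_snd D (ModuleCat.of T T))) hM hK, Category.comp_id _⟩

variable [IsNoetherianRing T]

/-- **SATURATION FROM TWO DECOMPOSITIONS.**  `T` noetherian; `V` a module with `Ωⁿ(mod T) ⊆ add V` (an
«Auslander module»: e.g. `n = 2`, `V = S` over `T = S^G`, Herzog's lemma below); `K_V` a first syzygy module of
`V` lying in `add (D ⊕ T)` for a finitely generated `D`; and `D` Ω-STABLE up to free summands: `D ∈ add (K_D ⊕ T)`
for a first syzygy module `K_D` of `D`.  Then **`ca(T) = caⁿ⁺²(T)`** (`n = 2`: `Sat₄`). [OURS · L1 w44b] -/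
theorem cohomologyAnnihilator_eq_of_cover_of_omegaStable {V KV D KD : ModuleCat.{u} T} [Module.Finite T D]
    (n : ℕ) (hcov : ∀ (M L : ModuleCat.{u} T), Module.Finite T M → IsSyzygy n M L → IsRetractOfPower V L)
    (hKV : IsSyzygy 1 V KV) (hKVD : IsRetractOfPower (ModuleCat.of T (D × T)) KV)
    (hKD : IsSyzygy 1 D KD) (hD : IsRetractOfPower (ModuleCat.of T (KD × T)) D) :
    cohomologyAnnihilator T = cohomologyAnnihilatorOfDegree T (n + 2) :=
  cohomologyAnnihilator_eq_of_recurrent_of_cover (IsRetractOfPower (ModuleCat.of T (D × T))) (n + 1)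
    finite_of_isRetractOfPower_prod_self (exists_retract_isSyzygy_of_omegaStable hKD hD)
    (exists_retract_of_isSyzygy_succ_of_cover hcov hKV hKVD)

/-- Levelled form: `caᵐ(T) = caⁿ⁺²(T)` for every `m ≥ n + 2`. [OURS · L1 w44b] -/
theorem cohomologyAnnihilatorOfDegree_eq_of_cover_of_omegaStable {V KV D KD : ModuleCat.{u} T}
    [Module.Finite T D] (n : ℕ)
    (hcov : ∀ (M L : ModuleCat.{u} T), Module.Finite T M → IsSyzygy n M L → IsRetractOfPower V L)
    (hKV : IsSyzygy 1 V KV) (hKVD : IsRetractOfPower (ModuleCat.of T (D × T)) KV)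
    (hKD : IsSyzygy 1 D KD) (hD : IsRetractOfPower (ModuleCat.of T (KD × T)) D) {m : ℕ} (hm : n + 2 ≤ m) :
    cohomologyAnnihilatorOfDegree T m = cohomologyAnnihilatorOfDegree T (n + 2) :=
  cohomologyAnnihilatorOfDegree_eq_of_recurrent_of_cover (IsRetractOfPower (ModuleCat.of T (D × T))) (n + 1)
    finite_of_isRetractOfPower_prod_self (exists_retract_isSyzygy_of_omegaStable hKD hD)
    (exists_retract_of_isSyzygy_succ_of_cover hcov hKV hKVD) hm

/-- **THE EXACT CENTRE: `ca(T) = s̲ann(D)`.**  Under the same two decompositions, `x ∈ ca(T)` iff `x` stably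
annihilates `D` (`⇒`: `D ∈ add (D ⊕ T)` is a member of the recurrent class; `⇐`: `s̲ann(D) = s̲ann(D ⊕ T)` passes to
`add (D ⊕ T) ⊇ Ωⁿ⁺¹(mod T)` and CA1).  For `U = k[u,v]^{μ_n(1,q)}`, `D = ⊕_t M_{n−i_t}`: `ca(U) = ⋂_t M_{i_t}M_{n−i_t}`.
[OURS · L1 w44b] -/
theorem mem_cohomologyAnnihilator_iff_stablyAnnihilates_of_cover_of_omegaStable {V KV D KD : ModuleCat.{u} T}
    [Module.Finite T D] (n : ℕ)
    (hcov : ∀ (M L : ModuleCat.{u} T), Module.Finite T M → IsSyzygy n M L → IsRetractOfPower V L)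
    (hKV : IsSyzygy 1 V KV) (hKVD : IsRetractOfPower (ModuleCat.of T (D × T)) KV)
    (hKD : IsSyzygy 1 D KD) (hD : IsRetractOfPower (ModuleCat.of T (KD × T)) D) (x : T) :
    x ∈ cohomologyAnnihilator T ↔ StablyAnnihilates T x D := by
  rw [mem_cohomologyAnnihilator_iff_forall_stablyAnnihilates_of_recurrent_of_cover
    (IsRetractOfPower (ModuleCat.of T (D × T))) (n + 1) finite_of_isRetractOfPower_prod_self
    (exists_retract_isSyzygy_of_omegaStable hKD hD) (exists_retract_of_isSyzygy_succ_of_cover hcov hKV hKVD) x]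
  constructor
  · intro h
    exact h D (isRetractOfPower_fst D (ModuleCat.of T T))
  · intro h X hX
    exact stablyAnnihilates_of_isRetractOfPower
      (StablyAnnihilates.prod_projective h (inferInstance : Module.Finite T (ModuleCat.of T T)) projective_self) hX

/-- Levelled form of the exact centre: `x ∈ caⁿ⁺²(T) ↔ x ∈ s̲ann(D)`. [OURS · L1 w44b] -/
theorem mem_cohomologyAnnihilatorOfDegree_iff_stablyAnnihilates_of_cover_of_omegaStable
    {V KV D KD : ModuleCat.{u} T} [Module.Finite T D] (n : ℕ)
    (hcov : ∀ (M L : ModuleCat.{u} T), Module.Finite T M → IsSyzygy n M L → IsRetractOfPower V L)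
    (hKV : IsSyzygy 1 V KV) (hKVD : IsRetractOfPower (ModuleCat.of T (D × T)) KV)
    (hKD : IsSyzygy 1 D KD) (hD : IsRetractOfPower (ModuleCat.of T (KD × T)) D) (x : T) :
    x ∈ cohomologyAnnihilatorOfDegree T (n + 2) ↔ StablyAnnihilates T x D := by
  rw [← mem_cohomologyAnnihilator_iff_stablyAnnihilates_of_cover_of_omegaStable n hcov hKV hKVD hKD hD x,
    cohomologyAnnihilator_eq_of_cover_of_omegaStable n hcov hKV hKVD hKD hD]

end Saturation

/-! ## Herzog's lemma, group-free: `Ω²(mod U) ⊆ add_U V` -/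

section Herzog

variable {U V : Type u} [CommRing U] [CommRing V] [Algebra U V]

/-- **Every `U`-module `N` is a `U`-retract of its coextension `Hom_U(V, N)`** as soon as the structure map
`U → V` has a `U`-linear retraction `ρ` with `ρ 1 = 1`: `j n = (v ↦ ρ(v) n)` and `ev₁ φ = φ 1` satisfy
`ev₁ ∘ j = id`, both `U`-linear for the restricted `V`-structure `(w • φ) v = φ (v w)`. [folklore] -/
theorem exists_retract_coind (ρ : V →ₗ[U] U) (hρ : ρ 1 = 1) (N : ModuleCat.{u} U) :
    ∃ (j : N ⟶ (restrictScalarsFunctor U V).obj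
        (ModuleCat.of V (((ModuleCat.restrictScalars (algebraMap U V)).obj (ModuleCat.of V V)) →ₗ[U] N)))
      (r : (restrictScalarsFunctor U V).obj
        (ModuleCat.of V (((ModuleCat.restrictScalars (algebraMap U V)).obj (ModuleCat.of V V)) →ₗ[U] N)) ⟶ N),
      j ≫ r = 𝟙 N := by
  -- the two identifications of the carrier of the source `V|_U` with `V`
  let toW : V → ((ModuleCat.restrictScalars (algebraMap U V)).obj (ModuleCat.of V V)) := fun v => v
  let ofW : ((ModuleCat.restrictScalars (algebraMap U V)).obj (ModuleCat.of V V)) → V := fun w => w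
  -- the carrier of the restricted coextension, with ITS `U`-structure `u • φ = (algebraMap u) • φ`
  let toC : (((ModuleCat.restrictScalars (algebraMap U V)).obj (ModuleCat.of V V)) →ₗ[U] N) →
      (restrictScalarsFunctor U V).obj
        (ModuleCat.of V (((ModuleCat.restrictScalars (algebraMap U V)).obj (ModuleCat.of V V)) →ₗ[U] N)) :=
    fun φ => φ
  let ofC : (restrictScalarsFunctor U V).obj
        (ModuleCat.of V (((ModuleCat.restrictScalars (algebraMap U V)).obj (ModuleCat.of V V)) →ₗ[U] N)) →
      (((ModuleCat.restrictScalars (algebraMap U V)).obj (ModuleCat.of V V)) →ₗ[U] N) :=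
    fun φ => φ
  have smul_ofC : ∀ (u : U) (c : (restrictScalarsFunctor U V).obj
      (ModuleCat.of V (((ModuleCat.restrictScalars (algebraMap U V)).obj (ModuleCat.of V V)) →ₗ[U] N))) (v),
      ofC (u • c) v = ofC c (toW (ofW v * algebraMap U V u)) :=
    fun _ _ _ => rfl
  -- `j n = (v ↦ ρ v • n)`
  let j₁ : N → (((ModuleCat.restrictScalars (algebraMap U V)).obj (ModuleCat.of V V)) →ₗ[U] N) := fun n =>
    { toFun := fun v => ρ (ofW v) • n
      map_add' := fun v w => by
        change ρ (ofW v + ofW w) • n = _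
        rw [map_add, add_smul]
      map_smul' := fun u v => by
        change ρ (algebraMap U V u * ofW v) • n = u • ρ (ofW v) • n
        rw [← Algebra.smul_def, map_smul, smul_eq_mul, mul_smul] }
  have j₁_apply : ∀ n v, j₁ n v = ρ (ofW v) • n := fun _ _ => rfl
  let j₀ : N →ₗ[U] (restrictScalarsFunctor U V).obj
      (ModuleCat.of V (((ModuleCat.restrictScalars (algebraMap U V)).obj (ModuleCat.of V V)) →ₗ[U] N)) :=
    { toFun := fun n => toC (j₁ n)
      map_add' := fun n n' => by
        change toC (j₁ (n + n')) = toC (j₁ n + j₁ n')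
        congr 1
        apply LinearMap.ext; intro v
        rw [LinearMap.add_apply, j₁_apply, j₁_apply, j₁_apply, smul_add]
      map_smul' := fun u n => by
        change toC (j₁ (u • n)) = u • toC (j₁ n)
        show j₁ (u • n) = ofC (u • toC (j₁ n))
        apply LinearMap.ext; intro v
        rw [smul_ofC, j₁_apply]
        change ρ (ofW v) • u • n = ρ (ofW v * algebraMap U V u) • n
        rw [mul_comm, ← Algebra.smul_def, map_smul, smul_eq_mul, mul_smul]
        exact smul_comm _ _ _ }
  -- `ev₁ φ = φ 1`
  let r₀ : (restrictScalarsFunctor U V).obj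
      (ModuleCat.of V (((ModuleCat.restrictScalars (algebraMap U V)).obj (ModuleCat.of V V)) →ₗ[U] N)) →ₗ[U] N :=
    { toFun := fun c => ofC c (toW 1)
      map_add' := fun φ ψ => rfl
      map_smul' := fun u c => by
        change ofC (u • c) (toW 1) = u • ofC c (toW 1)
        rw [smul_ofC, ← map_smul]
        congr 1
        change (1 : V) * algebraMap U V u = algebraMap U V u * 1
        rw [one_mul, mul_one] }
  refine ⟨ModuleCat.ofHom (X := N) (Y := (restrictScalarsFunctor U V).obj
      (ModuleCat.of V (((ModuleCat.restrictScalars (algebraMap U V)).obj (ModuleCat.of V V)) →ₗ[U] N))) j₀,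
    ModuleCat.ofHom (X := (restrictScalarsFunctor U V).obj
      (ModuleCat.of V (((ModuleCat.restrictScalars (algebraMap U V)).obj (ModuleCat.of V V)) →ₗ[U] N)))
      (Y := N) r₀, ?_⟩
  apply ModuleCat.hom_ext
  refine LinearMap.ext fun n => ?_
  change ρ (ofW (toW 1)) • n = n
  change ρ (1 : V) • n = n
  rw [hρ, one_smul]

/-- A finitely generated projective `V`-module lies in `add V`. [folklore] -/
theorem isRetractOfPower_self_of_projective (P : ModuleCat.{u} V) (hP : Module.Finite V P)
    (hproj : Projective P) : IsRetractOfPower (ModuleCat.of V V) P :=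
  IsRetractOfPower.of_projective (isRetractOfPower_self _) hP hproj

/-- **A second syzygy module stably annihilated by `1` lies in `add V`** (it is a retract of the finitely
generated projective through which `𝟙` factors).  In particular over a ring with `1 ∈ ca³(V)` (e.g. `k[u,v]`)
every second syzygy module of a finitely generated module lies in `add V`. [folklore] -/
theorem isRetractOfPower_self_of_isSyzygy_two [IsNoetherianRing V]
    (hV : (1 : V) ∈ cohomologyAnnihilatorOfDegree V 3) {X C : ModuleCat.{u} V} (hX : Module.Finite V X)
    (hC : IsSyzygy 2 X C) : IsRetractOfPower (ModuleCat.of V V) C := by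
  obtain ⟨P, hPfin, hPproj, ι, π, hιπ⟩ :=
    (mem_cohomologyAnnihilatorOfDegree_succ_iff_forall_isSyzygy (1 : V)).mp hV X C hX hC
  exact (isRetractOfPower_self_of_projective P hPfin hPproj).of_retract ι π (by rw [hιπ, one_smul])

/-- **HERZOG'S LEMMA (group-free form): `Ω²(mod U) ⊆ add_U (V|_U)`.**  Let `U → V` be an algebra with a
`U`-linear `ρ : V → U`, `ρ 1 = 1` (e.g. the Reynolds operator of a finite group with invertible order), such that
`Hom_U(V, U)` is a finitely generated projective `V`-module (Frobenius hypothesis; pseudo-reflection-free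
quotients) and `1 ∈ ca³(V)` (`V` noetherian; e.g. `V = k[u,v]`).  Then every second syzygy module `K` of a
finitely generated `U`-module is a `U`-direct summand of `Vᵐ|_U` for some `m`.  Proof: `K` is a `U`-retract of
`Hom_U(V, K)|_U` (`exists_retract_coind`); `Hom_U(V, K)` is a second `V`-syzygy (part 5
`exists_isSyzygy_two_coind`), so lies in `add_V V` (`isRetractOfPower_self_of_isSyzygy_two`); restrict scalars.
[folklore; Auslander 1986 / Herzog 1978 mechanism] -/
theorem isRetractOfPower_restrictScalars_of_isSyzygy_two [IsNoetherianRing V]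
    [Module.Finite V (((ModuleCat.restrictScalars (algebraMap U V)).obj (ModuleCat.of V V)) →ₗ[U] U)]
    [Module.Projective V (((ModuleCat.restrictScalars (algebraMap U V)).obj (ModuleCat.of V V)) →ₗ[U] U)]
    (ρ : V →ₗ[U] U) (hρ : ρ 1 = 1) (hV : (1 : V) ∈ cohomologyAnnihilatorOfDegree V 3)
    (M K : ModuleCat.{u} U) (hM : Module.Finite U M) (hK : IsSyzygy 2 M K) :
    IsRetractOfPower ((restrictScalarsFunctor U V).obj (ModuleCat.of V V)) K := by
  obtain ⟨X', hX'fin, hC⟩ := exists_isSyzygy_two_coind (U := U) (V := V) M K hM hK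
  obtain ⟨j, r, hjr⟩ := exists_retract_coind ρ hρ K
  exact ((isRetractOfPower_self_of_isSyzygy_two hV hX'fin hC).restrictScalars (R := U)).of_retract j r hjr

/-- **Herzog + cover step: `Ω³(mod U) ⊆ add_U (Ω(V|_U) ⊕ U)`** for any first `U`-syzygy module `K_V` of `V|_U`.
[folklore] -/
theorem isRetractOfPower_of_isSyzygy_three_of_herzog [IsNoetherianRing V]
    [Module.Finite V (((ModuleCat.restrictScalars (algebraMap U V)).obj (ModuleCat.of V V)) →ₗ[U] U)]
    [Module.Projective V (((ModuleCat.restrictScalars (algebraMap U V)).obj (ModuleCat.of V V)) →ₗ[U] U)]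
    (ρ : V →ₗ[U] U) (hρ : ρ 1 = 1) (hV : (1 : V) ∈ cohomologyAnnihilatorOfDegree V 3)
    {KV : ModuleCat.{u} U} (hKV : IsSyzygy 1 ((restrictScalarsFunctor U V).obj (ModuleCat.of V V)) KV)
    (M K : ModuleCat.{u} U) (hM : Module.Finite U M) (hK : IsSyzygy 3 M K) :
    IsRetractOfPower (ModuleCat.of U (KV × U)) K :=
  isRetractOfPower_of_isSyzygy_succ_of_cover
    (isRetractOfPower_restrictScalars_of_isSyzygy_two ρ hρ hV) hKV hM hK

/-- **`Sat₄` AND THE EXACT CENTRE FOR A QUOTIENT-TYPE ALGEBRA `U ⊆ V`** (Herzog hypotheses: retraction `ρ`,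
Frobenius, `1 ∈ ca³(V)`; `U`, `V` noetherian): given a first `U`-syzygy `K_V` of `V|_U` with `K_V ∈ add (D ⊕ U)`
and a first syzygy `K_D` of the finitely generated `U`-module `D` with `D ∈ add (K_D ⊕ U)`, we have
`ca(U) = ca⁴(U)` and `x ∈ ca(U) ↔ x ∈ s̲ann(D)`. [OURS · L1 w44b] -/
theorem cohomologyAnnihilator_eq_four_of_herzog [IsNoetherianRing U] [IsNoetherianRing V]
    [Module.Finite V (((ModuleCat.restrictScalars (algebraMap U V)).obj (ModuleCat.of V V)) →ₗ[U] U)]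
    [Module.Projective V (((ModuleCat.restrictScalars (algebraMap U V)).obj (ModuleCat.of V V)) →ₗ[U] U)]
    (ρ : V →ₗ[U] U) (hρ : ρ 1 = 1) (hV : (1 : V) ∈ cohomologyAnnihilatorOfDegree V 3)
    {KV D KD : ModuleCat.{u} U} [Module.Finite U D]
    (hKV : IsSyzygy 1 ((restrictScalarsFunctor U V).obj (ModuleCat.of V V)) KV)
    (hKVD : IsRetractOfPower (ModuleCat.of U (D × U)) KV)
    (hKD : IsSyzygy 1 D KD) (hD : IsRetractOfPower (ModuleCat.of U (KD × U)) D) :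
    cohomologyAnnihilator U = cohomologyAnnihilatorOfDegree U 4 ∧
      ∀ x : U, x ∈ cohomologyAnnihilator U ↔ StablyAnnihilates U x D :=
  ⟨cohomologyAnnihilator_eq_of_cover_of_omegaStable 2 (isRetractOfPower_restrictScalars_of_isSyzygy_two ρ hρ hV)
      hKV hKVD hKD hD,
    mem_cohomologyAnnihilator_iff_stablyAnnihilates_of_cover_of_omegaStable 2
      (isRetractOfPower_restrictScalars_of_isSyzygy_two ρ hρ hV) hKV hKVD hKD hD⟩

end Herzog

end Summit.ResolutionOfSingularities.ResolutionOfSingularities.Theorems.HomologicalConductor.PersistenceAuslanderAddCover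

end
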